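import Literature.Topology.FourManifolds.SimpleBranchedCover
import Literature.Topology.FourManifolds.ClosedSurfaceBraid
import Literature.Topology.FourManifolds.HomotopyS4CompactProofs
import Literature.Topology.FourManifolds.HomotopyS4OrientableProofs
import Mathlib
import HarnessLib

/-!
# Line `branch-two-knot-quotient`, degree two: the branch surface is nonempty

Helper for crux `ConvexBisection.AcyclicBisectionRigidity` (item stmt-SmoothPoincare4-10507), line
branch-two-knot-quotient, target stub `stub_twoKnotBranchedDoubleStandard` (a homotopy 4-sphere which is a
simple DOUBLE branched cover of `S⁴` along a closed surface is `S⁴`).  The degenerate reading "empty branch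
surface" of that stub is VACUOUS: a homotopy 4-sphere admits no simple branched cover of `S⁴` of degree `2`
with empty branch surface — it would be a 2-sheeted covering map onto the simply connected `S⁴`
(`isLocalHomeomorph_iff_isCoveringMap`), which has a continuous section through any point
(`IsCoveringMap.existsUnique_continuousMap_lifts` of the identity), and by uniqueness of lifts over the
simply connected total space the section is a two-sided inverse, contradicting `card_fibre = 2`.
So every instance of the target stub has a genuine branch surface (on paper a 2-knot by Smith theory).
Proved by the lead's wave-1 stub-worker; everything here is proved, no definitions. [folklore]
-/

noncomputable section

open scoped Manifold ContDiff Topology ContinuousMap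
open Set Function
open Literature.Topology.FourManifolds

set_option linter.dupNamespace false

namespace Summit.SmoothPoincare4.SmoothPoincare4.Theorems.AcyclicBisectionRigidity.BranchTwoKnotQuotient

local notation "𝔼 " n:arg => EuclideanSpace ℝ (Fin n)
local notation "𝕊⁴" => (Metric.sphere (0 : EuclideanSpace ℝ (Fin 5)) 1)

/-- **A degree-two simple branched cover of `S⁴` by a homotopy 4-sphere has NONEMPTY branch
surface**: otherwise `p` is a 2-sheeted covering map of the simply connected `S⁴` by the (simply)
connected `M`, which admits a global section that is a two-sided inverse. [folklore] -/
theorem nonempty_branchSurface_of_degree_two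
    (M : Type) [TopologicalSpace M] [T2Space M] [SecondCountableTopology M]
    [ChartedSpace (𝔼 4) M] [IsManifold (𝓡 4) ∞ M] (e : M ≃ₕ 𝕊⁴)
    (S : Type) [TopologicalSpace S] [ChartedSpace (𝔼 2) S]
    (f : S → 𝕊⁴) (ν : S × ℂ → 𝕊⁴) (σ : S × ℂ → M) (p : M → 𝕊⁴)
    (h : IsSimpleBranchedCover f ν σ p 2) : Nonempty S := by
  by_contra hS
  rw [not_nonempty_iff] at hS
  -- `M` is compact and simply connected (tree theorems), hence path connected
  haveI : CompactSpace M := compactSpace_of_homotopyEquiv_sphere_four_holds M e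
  haveI : SimplyConnectedSpace 𝕊⁴ := simplyConnectedSpace_sphere_four_holds
  haveI : SimplyConnectedSpace M := e.simplyConnectedSpace
  haveI : LocallyPathConnectedSpace M :=
    ChartedSpace.locallyPathConnectedSpace (𝔼 4) M
  haveI : LocallyPathConnectedSpace 𝕊⁴ :=
    ChartedSpace.locallyPathConnectedSpace (𝔼 4) 𝕊⁴
  -- no branch surface, no ramification tube: `p` is a local diffeomorphism everywhere
  have hσ : ∀ y : M, y ∉ range σ := fun y ⟨⟨s, _⟩, _⟩ => isEmptyElim s
  have hf : ∀ x : 𝕊⁴, x ∉ range f := fun x ⟨s, _⟩ => isEmptyElim s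
  have hloc : IsLocalDiffeomorph (𝓡 4) (𝓡 4) ∞ p := fun y =>
    (h.dichotomy y).resolve_right (hσ y)
  have hcov : IsCoveringMap p := isLocalHomeomorph_iff_isCoveringMap.1 hloc.isLocalHomeomorph
  -- a point downstairs and one of its two preimages
  obtain ⟨a₀⟩ : Nonempty 𝕊⁴ := ⟨e (e.symm (⟨EuclideanSpace.single 0 1, by simp⟩))⟩
  obtain ⟨e₀, he₀⟩ := h.surjective two_ne_zero a₀
  -- lift the identity of the simply connected base: a global section `F`
  obtain ⟨F, ⟨hF₀, hFp⟩, -⟩ :=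
    hcov.existsUnique_continuousMap_lifts (ContinuousMap.id 𝕊⁴) a₀ e₀ (by simpa using he₀)
  -- `F ∘ p` and `id` both lift `p` through `p` and agree at `e₀`; uniqueness over the simply
  -- connected `M` gives `F ∘ p = id`, so `p` is injective
  have hpc : Continuous p := h.continuous
  obtain ⟨G, -, huniq⟩ :=
    hcov.existsUnique_continuousMap_lifts ⟨p, hpc⟩ e₀ e₀ rfl
  have h1 : (F.comp ⟨p, hpc⟩ : C(M, M)) = G := huniq _ ⟨by simp [he₀, hF₀], by
    funext y
    have := congrFun hFp (p y)
    simpa only [comp_apply, ContinuousMap.comp_apply, ContinuousMap.coe_mk,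
      ContinuousMap.id_apply] using this⟩
  have h2 : (ContinuousMap.id M : C(M, M)) = G := huniq _ ⟨rfl, by ext; simp⟩
  have hinj : Injective p := by
    intro y y' hyy'
    have hy := congrFun (congrArg DFunLike.coe (h1.trans h2.symm)) y
    have hy' := congrFun (congrArg DFunLike.coe (h1.trans h2.symm)) y'
    simp only [ContinuousMap.comp_apply, ContinuousMap.coe_mk, ContinuousMap.id_apply] at hy hy'
    rw [← hy, ← hy', hyy']
  -- but the fibre over `a₀` has two points
  have hcard : Nat.card (p ⁻¹' {a₀}) = 2 := h.card_fibre a₀ (hf a₀)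
  have hsub : (p ⁻¹' {a₀}).Subsingleton := (Set.subsingleton_singleton).preimage hinj
  rcases hsub.eq_empty_or_singleton with h0 | ⟨y, hy⟩
  · rw [h0, Nat.card_coe_set_eq, Set.ncard_empty] at hcard
    exact absurd hcard (by norm_num)
  · rw [hy, Nat.card_coe_set_eq, Set.ncard_singleton] at hcard
    exact absurd hcard (by norm_num)

end Summit.SmoothPoincare4.SmoothPoincare4.Theorems.AcyclicBisectionRigidity.BranchTwoKnotQuotient

end
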